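/-
Copyright (c) 2026 the pub-hodgecm-mathlib formalisation cell (harness21).  Prover seat hodgecm-mathlib-LH4-p12 (g2), Track A «(D-RAM) FOUR-FRAME», unit U2H_HSide, ROW (2)
child (ρ2b′) «law₂ in fixed-point currency» (dealer LH4-plan (g11) WORD #18, tandem with LH4-p06 (g3)): the H-SIDE COUNT BRIDGE — the vertex-profile quotient
`Φ^st(γ_H, h_s)∕ν_s` of the (ρ2b)∕(ρ2b′) right-hand side IS a fixed-coset count on the type-(2) population (law-free).  2026-09-04.
-/
import Summits.HodgeConjecture.HodgeConjecture.Theorems.F0P3cDyRamHProfilesTypeOneAffineWild   -- ★ p856067 (this seat): §3 `support_hFamily_{zero,one}_eq_coe_prod_top`; brings ★ p855119 (type-(2) unfolding), ★ p855734 `measureReal_support_hFamily_ne_zero`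
import Summits.HodgeConjecture.HodgeConjecture.Theorems.F0P3cDyRamRowThreeReduction             -- ★ p855734 (LH4-p06 (g2)): `measureReal_support_hFamily_ne_zero` (the volumes `ν_s ≠ 0`)
import Summits.HodgeConjecture.HodgeConjecture.Theorems.F0P3cDyRamHProfilesTypeTwoAffineWild    -- ★ p856125 (this seat): brings ★ root stabiliser, ★ fixed cosets ↔ fixed vertices, ★ `rhoVertexActPlace_eq_iff_glVertexAct_eq`, ★ `finite_fixedBy_quotient_of_isClosed`
import HarnessLib

/-!
# Crux `H413`, line LH4 «(D-RAM) FOUR-FRAME», unit U2H (ii-H), ROW (2), child (ρ2b′) — THE H-SIDE COUNT BRIDGE: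
# on the type-(2) population `Φ^st(γ_H, hFamily s)∕ν_H(supp hFamily s) = #Fix_{γ₂}(U₂ ⧸ C_s)` (`C₀ = K₂`, `C₁ = K♯`), so law₂ can be cut MEASURE-FREE

Cell `hodgecm-mathlib` (D-0151), FLOOR 0, crux item H413 = `stmt-HodgeConjecture-24833`, route of record `HCCMUnconditional`; squad F0∕P3c∕LH4 (req620).  THEOREMS ONLY (no `def`,
no instance, no notation, no named fact, no `sorry`, default heartbeats); lane `--supports stmt-HodgeConjecture-24833 --as helper` (count-neutral).

WHY.  LH4-p06 (g3)'s cut of (ρ2b) `stub_U2H_gSide_typeTwo_unit0` (CUT REPORT 2026-09-04T00:32Z) leaves ONE sorried child (ρ2b′) `stub_U2H_fixedPointLaw_typeTwo_unit0` whose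
right-hand side is `(if d % 2 = 1 then Φ^st(γ_H, h₁)∕ν₁ else Φ^st(γ_H, h₀)∕ν₀) − 2(q^S − 1)∕(q − 1)`.  The first summand LOOKS measure-theoretic but is a COUNT: by the one-class
unfolding of the type-(2) profiles (★ p855119 `stableOrbitalIntegralRel_hFamily_zero_typeTwo` ∕ ★ `…indicator_sharp_eq_mul_natCard_fixedBy_of_not_exists_isRoot`), the supports
`supp h_s = C_s × U₁` (★ p856067 §3) and `ν_s ≠ 0` (★ p855734), `Φ^st(γ_H, h_s)∕ν_s = #Fix_{γ₂}(U₂ ⧸ C_s)` for EVERY `G`-regular type-(2) `γ_H` (no neighbourhood, no law).  So the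
census leaf of law₂ ((ρ2b′-X) in p06 (g3)'s letters) can be stated in pure fixed-point currency on both sides — `finTau·finWeylRatio·(#Fix_{δ₊}(G ⧸ K_t) − #Fix_{δ₋}(G ⧸ K_t)) =
#Fix_{γ₂}(U₂ ⧸ K_V) − 2[S]_q` — and the tree model reads `#Fix_{γ₂}(U₂ ⧸ K_V)` as the number of fixed VERTICES of any descent representative on the tree of `SL₂(L⁺_v)` (★
`natCard_fixedBy_cmLocalIntegralLevel_eq_ncard_setOf_glVertexAct_of_v_eq_one` at √u, ★ p847070 + ★ `natCard_fixedBy_eq_ncard_fixedBy_onePlace` at √π; place type = parity of `d`,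
★ p856067 §1).

* §1 `stableOrbitalIntegralRel_hFamily_zero_div_eq_natCard_fixedBy` (`s = 0` ↔ `K₂`), `stableOrbitalIntegralRel_hFamily_one_div_eq_natCard_fixedBy` (`s = 1` ↔ any matched `K♯`).
* §2 the (ρ2b′) selector: `vertexProfile_div_eq_natCard_fixedBy_of_mod_two_eq_zero` (`d` even ⇒ `= #Fix(U₂ ⧸ K₂)`), `…_of_mod_two_eq_one` (`d` odd ⇒ `= #Fix(U₂ ⧸ K♯)`).
* §3 `exists_nhds_vertexProfile_div_eq_natCard_fixedBy_add_mod_two` — BINDER-FREE COUNT CURRENCY near `1`: for the datum of record `(σ_w, ϖ, d, t_E)`,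
  `(if d % 2 = 1 then Φ₁∕ν₁ else Φ₀∕ν₀) = #Fix_{γ₂}(U₂ ⧸ K₂) + d % 2` on the type-(2) population in a neighbourhood of `1` (at √π the `K♯`-count exceeds the `K₂`-count by
  exactly one — ★ `SLTwoTreeFixedSubtreeCount` §3 on the root-stabiliser neighbourhood of ★ p856125's proof; place type = parity of `d`, ★ p856067 §1) — so (ρ2b′-X)'s right-hand
  side can be typed as `((Nat.card (fixedBy (U₂ ⧸ K₂) γH.1) : ℂ) + ((d % 2 : ℕ) : ℂ)) − 2(q^S − 1)∕(q − 1)` with NO `K♯` binder.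

HONEST LABEL.  Count-neutral, law-free; nothing printed is asserted; `HC_CM` is proved only modulo the 7 printed citations (2 remaining named inputs: hLiu418 =
`stmt-HodgeConjecture-24832`, h413 = `stmt-HodgeConjecture-24833`) until rung 0 closes.

## References
* [Rogawski1990] J. D. Rogawski, *Automorphic Representations of Unitary Groups in Three Variables*, Ann. of Math. Stud. 123 (1990): §4.9 Prop. 4.9.1 (b) p. 55, Lemma 4.9.3
  p. 56 (the `H`-side terms); §4.3 (4.3.1) p. 43 (orbital integrals of indicators).
* [Kottwitz1988] R. E. Kottwitz, *Tamagawa numbers*, Ann. of Math. 127 (1988), §2 (orbital integrals of indicators as fixed-coset counts).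
-/

set_option autoImplicit false

noncomputable section

namespace Summit.HodgeConjecture.HodgeConjecture.Cruxes.H413.F0P3cDyRamHProfilesTypeTwoVertexCount

open MeasureTheory Measure NumberField IsDedekindDomain Topology Filter MulAction Matrix WithZero ValuativeRel
open Literature.NumberTheory.Automorphic Literature.NumberTheory.Automorphic.UnitaryGroup Literature.NumberTheory.Automorphic.IntegralReduction
open Literature.NumberTheory.Rogawski1990 Literature.NumberTheory.GaloisRepresentations
open Literature.NumberTheory.Automorphic.UnitaryThreeFourFrame
open Literature.NumberTheory.Automorphic.HermitianLatticeTree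
open Literature.NumberTheory.Automorphic.UnitaryLatticeTree Literature.NumberTheory.Automorphic.HermitianLattice
open Summit.HodgeConjecture.HodgeConjecture.Cruxes.H413.F0P3cDyRamFourFrameHSideDefs
open Summit.HodgeConjecture.HodgeConjecture.Cruxes.H413.F0P3cDyRamFourFrameHFamilyDefs
open Summit.HodgeConjecture.HodgeConjecture.Cruxes.H413.F0P3cDyRamHProfilesTypeTwoUnfolding (hFamily_zero hFamily_one stableOrbitalIntegralRel_hFamily_zero_typeTwo)
open Summit.HodgeConjecture.HodgeConjecture.Cruxes.H413.F0P3cDyRamHProfilesTypeOneAffineWild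
open Summit.HodgeConjecture.HodgeConjecture.Cruxes.H413.F0P3cDyRamRowThreeReduction (measureReal_support_hFamily_ne_zero)
open scoped Matrix MatrixGroups Classical ValuativeRel WithZero

section Place

variable (L : Type) [Field L] [NumberField L] [IsCMField L] {v : HeightOneSpectrum (𝓞 ↥(maximalRealSubfield L))}
  (w : PlacesOver L v) (hw : IsCMField.complexConj L • w.1 = w.1) (he : v.asIdeal.ramificationIdx' w.1.asIdeal ≠ 1)
  [MeasurableSpace ((cmDatum L 2 (Matrix.of fun i j : Fin 2 => if i.val + j.val + 1 = 2 then (1 : L) else 0)).Local v × (cmDatum L 1 (Matrix.of fun i j : Fin 1 => if i.val + j.val + 1 = 1 then (1 : L) else 0)).Local v)]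
  [BorelSpace ((cmDatum L 2 (Matrix.of fun i j : Fin 2 => if i.val + j.val + 1 = 2 then (1 : L) else 0)).Local v × (cmDatum L 1 (Matrix.of fun i j : Fin 1 => if i.val + j.val + 1 = 1 then (1 : L) else 0)).Local v)]
  [∀ a : ((cmDatum L 2 (Matrix.of fun i j : Fin 2 => if i.val + j.val + 1 = 2 then (1 : L) else 0)).Local v × (cmDatum L 1 (Matrix.of fun i j : Fin 1 => if i.val + j.val + 1 = 1 then (1 : L) else 0)).Local v), MeasurableSpace (((cmDatum L 2 (Matrix.of fun i j : Fin 2 => if i.val + j.val + 1 = 2 then (1 : L) else 0)).Local v × (cmDatum L 1 (Matrix.of fun i j : Fin 1 => if i.val + j.val + 1 = 1 then (1 : L) else 0)).Local v) ⧸ Subgroup.centralizer ({a} : Set ((cmDatum L 2 (Matrix.of fun i j : Fin 2 => if i.val + j.val + 1 = 2 then (1 : L) else 0)).Local v × (cmDatum L 1 (Matrix.of fun i j : Fin 1 => if i.val + j.val + 1 = 1 then (1 : L) else 0)).Local v)))]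
  [∀ a : ((cmDatum L 2 (Matrix.of fun i j : Fin 2 => if i.val + j.val + 1 = 2 then (1 : L) else 0)).Local v × (cmDatum L 1 (Matrix.of fun i j : Fin 1 => if i.val + j.val + 1 = 1 then (1 : L) else 0)).Local v), BorelSpace (((cmDatum L 2 (Matrix.of fun i j : Fin 2 => if i.val + j.val + 1 = 2 then (1 : L) else 0)).Local v × (cmDatum L 1 (Matrix.of fun i j : Fin 1 => if i.val + j.val + 1 = 1 then (1 : L) else 0)).Local v) ⧸ Subgroup.centralizer ({a} : Set ((cmDatum L 2 (Matrix.of fun i j : Fin 2 => if i.val + j.val + 1 = 2 then (1 : L) else 0)).Local v × (cmDatum L 1 (Matrix.of fun i j : Fin 1 => if i.val + j.val + 1 = 1 then (1 : L) else 0)).Local v)))]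
  (νH : Measure ((cmDatum L 2 (Matrix.of fun i j : Fin 2 => if i.val + j.val + 1 = 2 then (1 : L) else 0)).Local v × (cmDatum L 1 (Matrix.of fun i j : Fin 1 => if i.val + j.val + 1 = 1 then (1 : L) else 0)).Local v)) [νH.IsHaarMeasure] [νH.IsMulRightInvariant]

/-! ## §1 The two profiles as fixed-coset counts (type (2), any ramified non-split place) -/

include hw he in
/-- **`Φ^st(γ_H, hFamily 0)∕ν_H(supp hFamily 0) = #Fix_{γ₂}(U₂ ⧸ K₂)`** for every `G`-regular TYPE-(2) `γ_H` (no `w`-eigenvalue in `L_w`): one stable class (★ p855119), `supp = K₂ × U₁`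
(★ p856067 §3), `ν_H(K₂ × U₁) ≠ 0` (★ p855734). Law-free, neighbourhood-free. [cite: Rogawski1990, §4.9 Prop. 4.9.1 (b) p. 55; §4.3 (4.3.1) p. 43] [cite: Kottwitz1988, §2] -/
theorem stableOrbitalIntegralRel_hFamily_zero_div_eq_natCard_fixedBy (ϖ : w.1.adicCompletion L) (hϖ : Valued.v ϖ = WithZero.exp (-1 : ℤ))
    {mH : OrbitalMeasureFamily ((cmDatum L 2 (Matrix.of fun i j : Fin 2 => if i.val + j.val + 1 = 2 then (1 : L) else 0)).Local v × (cmDatum L 1 (Matrix.of fun i j : Fin 1 => if i.val + j.val + 1 = 1 then (1 : L) else 0)).Local v)} (hmH : mH.IsCanonical (IsLocalGRegular L v) νH)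
    {γH : ((cmDatum L 2 (Matrix.of fun i j : Fin 2 => if i.val + j.val + 1 = 2 then (1 : L) else 0)).Local v × (cmDatum L 1 (Matrix.of fun i j : Fin 1 => if i.val + j.val + 1 = 1 then (1 : L) else 0)).Local v)} (hreg : IsLocalGRegular L v γH)
    (hirr : ¬ ∃ x : (w.1.adicCompletion L), ((((γH.1.val : GL (Fin 2) (UnitaryGroup.LocalRing L v)).val.map (Pi.evalRingHom (fun w' : PlacesOver L v => w'.1.adicCompletion L) w))).charpoly).IsRoot x) :
    stableOrbitalIntegralRel (IsLocalStablyConjH L v) mH (hFamily L w hw ϖ 0) γH / (νH.real (Function.support (hFamily L w hw ϖ 0)) : ℂ) =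
      (Nat.card (fixedBy (((cmDatum L 2 (Matrix.of fun i j : Fin 2 => if i.val + j.val + 1 = 2 then (1 : L) else 0)).Local v) ⧸
        cmLocalIntegralLevel L 2 (Matrix.of fun i j : Fin 2 => if i.val + j.val + 1 = 2 then (1 : L) else 0) v) γH.1) : ℂ) := by
  have hν := measureReal_support_hFamily_ne_zero L w hw he ϖ hϖ νH 0
  rw [stableOrbitalIntegralRel_hFamily_zero_typeTwo L w hw νH ϖ hmH hreg hirr]
  rw [support_hFamily_zero_eq_coe_prod_top L w hw ϖ] at hν ⊢
  rw [mul_div_cancel_left₀ _ hν]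

include hw he in
/-- **`Φ^st(γ_H, hFamily 1)∕ν_H(supp hFamily 1) = #Fix_{γ₂}(U₂ ⧸ K♯)`** for every `G`-regular TYPE-(2) `γ_H` and any compact open `K♯ ≤ U₂` matched with `D_ϖ GL₂(𝒪_w) D_ϖ⁻¹`
(★ `…indicator_sharp_eq_mul_natCard_fixedBy_of_not_exists_isRoot`, ★ p856067 §3, ★ p855734). Law-free. [cite: Rogawski1990, §4.9 Lemma 4.9.3 p. 56; §4.3 (4.3.1) p. 43] [cite: Kottwitz1988, §2] -/
theorem stableOrbitalIntegralRel_hFamily_one_div_eq_natCard_fixedBy (ϖ : (w.1.adicCompletion L)ˣ) (hϖ : Valued.v (ϖ : w.1.adicCompletion L) = WithZero.exp (-1 : ℤ))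
    (Ksh : Subgroup ((cmDatum L 2 (Matrix.of fun i j : Fin 2 => if i.val + j.val + 1 = 2 then (1 : L) else 0)).Local v))
    (hKsh : ∀ g, g ∈ Ksh ↔
        (((localNonsplitEquiv (IsCMField.complexConj L) (Matrix.of fun i j : Fin 2 => if i.val + j.val + 1 = 2 then (1 : L) else 0) (IsCMField.complexConj_ne_one L) w hw) g : ↥(unitaryGroupOfForm (galAdicCompletionMap (L := L) (IsCMField.complexConj L) hw) (placeForm (Matrix.of fun i j : Fin 2 => if i.val + j.val + 1 = 2 then (1 : L) else 0) w.1))) : GL (Fin 2) (w.1.adicCompletion L)) ∈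
          (glInt 2 (w.1.adicCompletion L)).map (MulAut.conj (glDiagonal 2 (w.1.adicCompletion L) ![1, ϖ])).toMonoidHom)
    (hKo : IsOpen (Ksh : Set ((cmDatum L 2 (Matrix.of fun i j : Fin 2 => if i.val + j.val + 1 = 2 then (1 : L) else 0)).Local v)))
    (hKc : IsCompact (Ksh : Set ((cmDatum L 2 (Matrix.of fun i j : Fin 2 => if i.val + j.val + 1 = 2 then (1 : L) else 0)).Local v)))
    {mH : OrbitalMeasureFamily ((cmDatum L 2 (Matrix.of fun i j : Fin 2 => if i.val + j.val + 1 = 2 then (1 : L) else 0)).Local v × (cmDatum L 1 (Matrix.of fun i j : Fin 1 => if i.val + j.val + 1 = 1 then (1 : L) else 0)).Local v)} (hmH : mH.IsCanonical (IsLocalGRegular L v) νH)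
    {γH : ((cmDatum L 2 (Matrix.of fun i j : Fin 2 => if i.val + j.val + 1 = 2 then (1 : L) else 0)).Local v × (cmDatum L 1 (Matrix.of fun i j : Fin 1 => if i.val + j.val + 1 = 1 then (1 : L) else 0)).Local v)} (hreg : IsLocalGRegular L v γH)
    (hirr : ¬ ∃ x : (w.1.adicCompletion L), ((((γH.1.val : GL (Fin 2) (UnitaryGroup.LocalRing L v)).val.map (Pi.evalRingHom (fun w' : PlacesOver L v => w'.1.adicCompletion L) w))).charpoly).IsRoot x) :
    stableOrbitalIntegralRel (IsLocalStablyConjH L v) mH (hFamily L w hw (ϖ : w.1.adicCompletion L) 1) γH / (νH.real (Function.support (hFamily L w hw (ϖ : w.1.adicCompletion L) 1)) : ℂ) =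
      (Nat.card (fixedBy (((cmDatum L 2 (Matrix.of fun i j : Fin 2 => if i.val + j.val + 1 = 2 then (1 : L) else 0)).Local v) ⧸ Ksh) γH.1) : ℂ) := by
  have hν := measureReal_support_hFamily_ne_zero L w hw he (ϖ : w.1.adicCompletion L) hϖ νH 1
  have hΦ : stableOrbitalIntegralRel (IsLocalStablyConjH L v) mH (hFamily L w hw (ϖ : w.1.adicCompletion L) 1) γH =
      (νH.real (((Ksh.prod (⊤ : Subgroup ((cmDatum L 1 (Matrix.of fun i j : Fin 1 => if i.val + j.val + 1 = 1 then (1 : L) else 0)).Local v))) :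
        Subgroup ((cmDatum L 2 (Matrix.of fun i j : Fin 2 => if i.val + j.val + 1 = 2 then (1 : L) else 0)).Local v ×
          (cmDatum L 1 (Matrix.of fun i j : Fin 1 => if i.val + j.val + 1 = 1 then (1 : L) else 0)).Local v)) :
        Set ((cmDatum L 2 (Matrix.of fun i j : Fin 2 => if i.val + j.val + 1 = 2 then (1 : L) else 0)).Local v ×
          (cmDatum L 1 (Matrix.of fun i j : Fin 1 => if i.val + j.val + 1 = 1 then (1 : L) else 0)).Local v)) : ℂ) *
        (Nat.card (fixedBy (((cmDatum L 2 (Matrix.of fun i j : Fin 2 => if i.val + j.val + 1 = 2 then (1 : L) else 0)).Local v) ⧸ Ksh) γH.1) : ℂ) := by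
    rw [hFamily_one]
    exact stableOrbitalIntegralRel_indicator_sharp_eq_mul_natCard_fixedBy_of_not_exists_isRoot L v w hw νH hmH ϖ Ksh hKsh hKo hKc hreg hirr
  rw [hΦ]
  rw [support_hFamily_one_eq_coe_prod_top L w hw ϖ Ksh hKsh] at hν ⊢
  rw [mul_div_cancel_left₀ _ hν]

/-! ## §2 The (ρ2b′) selector `if d % 2 = 1 then Φ₁∕ν₁ else Φ₀∕ν₀` as a count -/

include hw he in
/-- **`d` EVEN (√u-type place): the (ρ2b′) H-side selector is `#Fix_{γ₂}(U₂ ⧸ K₂)`** on the type-(2) population (the vertex profile is `s = 0`). [cite: Rogawski1990, §4.9 Prop. 4.9.1 (b) p. 55] [cite: Kottwitz1988, §2] -/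
theorem vertexProfile_div_eq_natCard_fixedBy_of_mod_two_eq_zero {d : ℕ} (hd : d % 2 = 0)
    (ϖ : w.1.adicCompletion L) (hϖ : Valued.v ϖ = WithZero.exp (-1 : ℤ))
    {mH : OrbitalMeasureFamily ((cmDatum L 2 (Matrix.of fun i j : Fin 2 => if i.val + j.val + 1 = 2 then (1 : L) else 0)).Local v × (cmDatum L 1 (Matrix.of fun i j : Fin 1 => if i.val + j.val + 1 = 1 then (1 : L) else 0)).Local v)} (hmH : mH.IsCanonical (IsLocalGRegular L v) νH)
    {γH : ((cmDatum L 2 (Matrix.of fun i j : Fin 2 => if i.val + j.val + 1 = 2 then (1 : L) else 0)).Local v × (cmDatum L 1 (Matrix.of fun i j : Fin 1 => if i.val + j.val + 1 = 1 then (1 : L) else 0)).Local v)} (hreg : IsLocalGRegular L v γH)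
    (hirr : ¬ ∃ x : (w.1.adicCompletion L), ((((γH.1.val : GL (Fin 2) (UnitaryGroup.LocalRing L v)).val.map (Pi.evalRingHom (fun w' : PlacesOver L v => w'.1.adicCompletion L) w))).charpoly).IsRoot x) :
    (if d % 2 = 1 then stableOrbitalIntegralRel (IsLocalStablyConjH L v) mH (hFamily L w hw ϖ 1) γH / (νH.real (Function.support (hFamily L w hw ϖ 1)) : ℂ)
      else stableOrbitalIntegralRel (IsLocalStablyConjH L v) mH (hFamily L w hw ϖ 0) γH / (νH.real (Function.support (hFamily L w hw ϖ 0)) : ℂ)) =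
      (Nat.card (fixedBy (((cmDatum L 2 (Matrix.of fun i j : Fin 2 => if i.val + j.val + 1 = 2 then (1 : L) else 0)).Local v) ⧸
        cmLocalIntegralLevel L 2 (Matrix.of fun i j : Fin 2 => if i.val + j.val + 1 = 2 then (1 : L) else 0) v) γH.1) : ℂ) := by
  rw [if_neg (by omega)]
  exact stableOrbitalIntegralRel_hFamily_zero_div_eq_natCard_fixedBy L w hw he νH ϖ hϖ hmH hreg hirr

include hw he in
/-- **`d` ODD (√π-type place): the (ρ2b′) H-side selector is `#Fix_{γ₂}(U₂ ⧸ K♯)`** on the type-(2) population, for any matched compact open `K♯` (the vertex profile is `s = 1`).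
[cite: Rogawski1990, §4.9 Lemma 4.9.3 p. 56] [cite: Kottwitz1988, §2] -/
theorem vertexProfile_div_eq_natCard_fixedBy_of_mod_two_eq_one {d : ℕ} (hd : d % 2 = 1)
    (ϖ : (w.1.adicCompletion L)ˣ) (hϖ : Valued.v (ϖ : w.1.adicCompletion L) = WithZero.exp (-1 : ℤ))
    (Ksh : Subgroup ((cmDatum L 2 (Matrix.of fun i j : Fin 2 => if i.val + j.val + 1 = 2 then (1 : L) else 0)).Local v))
    (hKsh : ∀ g, g ∈ Ksh ↔
        (((localNonsplitEquiv (IsCMField.complexConj L) (Matrix.of fun i j : Fin 2 => if i.val + j.val + 1 = 2 then (1 : L) else 0) (IsCMField.complexConj_ne_one L) w hw) g : ↥(unitaryGroupOfForm (galAdicCompletionMap (L := L) (IsCMField.complexConj L) hw) (placeForm (Matrix.of fun i j : Fin 2 => if i.val + j.val + 1 = 2 then (1 : L) else 0) w.1))) : GL (Fin 2) (w.1.adicCompletion L)) ∈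
          (glInt 2 (w.1.adicCompletion L)).map (MulAut.conj (glDiagonal 2 (w.1.adicCompletion L) ![1, ϖ])).toMonoidHom)
    (hKo : IsOpen (Ksh : Set ((cmDatum L 2 (Matrix.of fun i j : Fin 2 => if i.val + j.val + 1 = 2 then (1 : L) else 0)).Local v)))
    (hKc : IsCompact (Ksh : Set ((cmDatum L 2 (Matrix.of fun i j : Fin 2 => if i.val + j.val + 1 = 2 then (1 : L) else 0)).Local v)))
    {mH : OrbitalMeasureFamily ((cmDatum L 2 (Matrix.of fun i j : Fin 2 => if i.val + j.val + 1 = 2 then (1 : L) else 0)).Local v × (cmDatum L 1 (Matrix.of fun i j : Fin 1 => if i.val + j.val + 1 = 1 then (1 : L) else 0)).Local v)} (hmH : mH.IsCanonical (IsLocalGRegular L v) νH)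
    {γH : ((cmDatum L 2 (Matrix.of fun i j : Fin 2 => if i.val + j.val + 1 = 2 then (1 : L) else 0)).Local v × (cmDatum L 1 (Matrix.of fun i j : Fin 1 => if i.val + j.val + 1 = 1 then (1 : L) else 0)).Local v)} (hreg : IsLocalGRegular L v γH)
    (hirr : ¬ ∃ x : (w.1.adicCompletion L), ((((γH.1.val : GL (Fin 2) (UnitaryGroup.LocalRing L v)).val.map (Pi.evalRingHom (fun w' : PlacesOver L v => w'.1.adicCompletion L) w))).charpoly).IsRoot x) :
    (if d % 2 = 1 then stableOrbitalIntegralRel (IsLocalStablyConjH L v) mH (hFamily L w hw (ϖ : w.1.adicCompletion L) 1) γH / (νH.real (Function.support (hFamily L w hw (ϖ : w.1.adicCompletion L) 1)) : ℂ)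
      else stableOrbitalIntegralRel (IsLocalStablyConjH L v) mH (hFamily L w hw (ϖ : w.1.adicCompletion L) 0) γH / (νH.real (Function.support (hFamily L w hw (ϖ : w.1.adicCompletion L) 0)) : ℂ)) =
      (Nat.card (fixedBy (((cmDatum L 2 (Matrix.of fun i j : Fin 2 => if i.val + j.val + 1 = 2 then (1 : L) else 0)).Local v) ⧸ Ksh) γH.1) : ℂ) := by
  rw [if_pos hd]
  exact stableOrbitalIntegralRel_hFamily_one_div_eq_natCard_fixedBy L w hw he νH ϖ hϖ Ksh hKsh hKo hKc hmH hreg hirr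

/-! ## §3 Binder-free count currency near `1`: `#Fix_{γ₂}(U₂ ⧸ K_V) = #Fix_{γ₂}(U₂ ⧸ K₂) + d % 2` -/

include hw he in
/-- **THE (ρ2b′) H-SIDE SELECTOR IN BINDER-FREE COUNT CURRENCY**: for the datum of record `(σ_w, ϖ, d, t_E)` there is `V ∈ 𝓝 (1 : H_v)` (the root-stabiliser neighbourhood
`K × U₁` of ★ p856125) such that for every `G`-regular TYPE-(2) `γ_H ∈ V`:
`(if d % 2 = 1 then Φ^st(γ_H, h₁)∕ν₁ else Φ^st(γ_H, h₀)∕ν₀) = #Fix_{γ₂}(U₂ ⧸ K₂) + d % 2` — at a √u place (`d` even, ★ p856067 §1) the vertex profile is `s = 0` (§2); at a √π place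
(`d` odd) it is `s = 1`, `= #Fix(U₂ ⧸ K♯)` (§1), and `#Fix(U₂ ⧸ K₂) + 1 = #Fix(U₂ ⧸ K♯)` (★ `natCard_fixedBy_cmLocalIntegralLevel_add_one_eq_natCard_fixedBy_modular_of_v_eq_exp_neg_one`: one
fewer fixed edge than fixed vertices on the finite fixed subtree; `hx₀` on `V`, `hfin` from the compact centraliser — as in ★ p856125).  Law-free.
[cite: Rogawski1990, §4.9 Prop. 4.9.1 (b) p. 55, Lemma 4.9.3 p. 56] [cite: Kottwitz1988, §2] -/
theorem exists_nhds_vertexProfile_div_eq_natCard_fixedBy_add_mod_two (ϖ : w.1.adicCompletion L) (hϖ : Valued.v ϖ = WithZero.exp (-1 : ℤ)) (d tE : ℕ)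
    (hD : IsRamifiedQuadraticDatum (galAdicCompletionMap (L := L) (IsCMField.complexConj L) hw) ϖ d tE)
    (mH : OrbitalMeasureFamily ((cmDatum L 2 (Matrix.of fun i j : Fin 2 => if i.val + j.val + 1 = 2 then (1 : L) else 0)).Local v × (cmDatum L 1 (Matrix.of fun i j : Fin 1 => if i.val + j.val + 1 = 1 then (1 : L) else 0)).Local v)) (hmH : mH.IsCanonical (IsLocalGRegular L v) νH) :
    ∃ V ∈ 𝓝 (1 : ((cmDatum L 2 (Matrix.of fun i j : Fin 2 => if i.val + j.val + 1 = 2 then (1 : L) else 0)).Local v × (cmDatum L 1 (Matrix.of fun i j : Fin 1 => if i.val + j.val + 1 = 1 then (1 : L) else 0)).Local v)),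
      ∀ γH ∈ V, IsLocalGRegular L v γH →
        (¬ ∃ x : (w.1.adicCompletion L), ((((γH.1.val : GL (Fin 2) (UnitaryGroup.LocalRing L v)).val.map (Pi.evalRingHom (fun w' : PlacesOver L v => w'.1.adicCompletion L) w))).charpoly).IsRoot x) →
        (if d % 2 = 1 then stableOrbitalIntegralRel (IsLocalStablyConjH L v) mH (hFamily L w hw ϖ 1) γH / (νH.real (Function.support (hFamily L w hw ϖ 1)) : ℂ)
          else stableOrbitalIntegralRel (IsLocalStablyConjH L v) mH (hFamily L w hw ϖ 0) γH / (νH.real (Function.support (hFamily L w hw ϖ 0)) : ℂ)) =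
          (Nat.card (fixedBy (((cmDatum L 2 (Matrix.of fun i j : Fin 2 => if i.val + j.val + 1 = 2 then (1 : L) else 0)).Local v) ⧸
            cmLocalIntegralLevel L 2 (Matrix.of fun i j : Fin 2 => if i.val + j.val + 1 = 2 then (1 : L) else 0) v) γH.1) : ℂ) + ((d % 2 : ℕ) : ℂ) := by
  -- `ϖ ≠ 0`; make it a unit
  have hϖ0 : ϖ ≠ 0 := fun h0 => by rw [h0, map_zero] at hϖ; exact WithZero.zero_ne_coe hϖ
  obtain ⟨ϖu, rfl⟩ : ∃ ϖu : (w.1.adicCompletion L)ˣ, (ϖu : w.1.adicCompletion L) = ϖ := ⟨Units.mk0 ϖ hϖ0, rfl⟩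
  have hϖF : Valued.v (HeckeCharacter.uniformizer ↥(maximalRealSubfield L) v : v.adicCompletion ↥(maximalRealSubfield L)) = WithZero.exp (-1 : ℤ) :=
    HeckeCharacter.valued_uniformizer v
  haveI : IsDiscreteValuationRing 𝒪[v.adicCompletion ↥(maximalRealSubfield L)] := isDiscreteValuationRing_integer_of_compatible hϖF
  obtain ⟨α₀, hα₀, hvα₀⟩ := exists_units_galAdicCompletionMap_complexConj_eq_neg_of_ramified L w hw he
  have hα₀0 : (α₀ : w.1.adicCompletion L) ≠ 0 := α₀.ne_zero
  have hx₀S : IsSpecialLattice (RingHom.id (v.adicCompletion ↥(maximalRealSubfield L))) (HeckeCharacter.uniformizer ↥(maximalRealSubfield L) v : v.adicCompletion ↥(maximalRealSubfield L))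
      !![(0 : v.adicCompletion ↥(maximalRealSubfield L)), 1; -1, 0] (latt (1 : Matrix (Fin 2) (Fin 2) (v.adicCompletion ↥(maximalRealSubfield L)))) := by
    have h1 := isSpecialLattice_latt_of_valuation_det (isUniformizingElement_of_v_eq hϖF).ne_zero (1 : GL (Fin 2) (v.adicCompletion ↥(maximalRealSubfield L))) (e := 0) (Or.inl rfl)
      (by rw [Units.val_one, Matrix.det_one, zpow_zero])
    rwa [Units.val_one] at h1
  obtain ⟨K, hK, hKo, hKc⟩ := exists_rootStabilizer_rhoVertexActPlace L v w hw he hα₀ hα₀0 hvα₀ hϖF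
    (localNonsplitEquiv (IsCMField.complexConj L) (Matrix.of fun i j : Fin 2 => if i.val + j.val + 1 = 2 then (1 : L) else 0) (IsCMField.complexConj_ne_one L) w hw) (fun _ => rfl)
    ⟨latt (1 : Matrix (Fin 2) (Fin 2) (v.adicCompletion ↥(maximalRealSubfield L))), hx₀S⟩ rfl
  refine ⟨((K.prod (⊤ : Subgroup ((cmDatum L 1 (Matrix.of fun i j : Fin 1 => if i.val + j.val + 1 = 1 then (1 : L) else 0)).Local v))) :
      Subgroup ((cmDatum L 2 (Matrix.of fun i j : Fin 2 => if i.val + j.val + 1 = 2 then (1 : L) else 0)).Local v ×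
        (cmDatum L 1 (Matrix.of fun i j : Fin 1 => if i.val + j.val + 1 = 1 then (1 : L) else 0)).Local v)), hKo.mem_nhds (one_mem _), ?_⟩
  intro γH hγ hreg hirr
  rcases hvα₀ with hvα₀ | hvα₀
  · -- √u-type place: `d` even, the vertex profile is `s = 0`
    have hd2 : d % 2 = 0 := mod_two_eq_zero_of_antiFixed_of_v_eq_one hD hα₀ hvα₀
    rw [vertexProfile_div_eq_natCard_fixedBy_of_mod_two_eq_zero L w hw he νH hd2 (ϖu : w.1.adicCompletion L) hϖ hmH hreg hirr, hd2, Nat.cast_zero, add_zero]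
  · -- √π-type place: `d` odd, the vertex profile is `s = 1`, and `#Fix(U₂⧸K₂) + 1 = #Fix(U₂⧸K♯)` on the root-stabiliser neighbourhood
    have hd2 : d % 2 = 1 := mod_two_eq_one_of_antiFixed_of_v_eq_exp_neg_one hD hα₀ hvα₀
    set U := (localNonsplitEquiv (IsCMField.complexConj L) (Matrix.of fun i j : Fin 2 => if i.val + j.val + 1 = 2 then (1 : L) else 0) (IsCMField.complexConj_ne_one L) w hw) γH.1 with hUdef
    obtain ⟨s₀, g, hs, hsg⟩ := descent_of_mem_unitaryGroupOfForm_antidiag L v w hw hα₀ hα₀0 _ (coe_mem_unitaryGroupOfForm_antidiag_two_of_mem_placeForm L w hw U)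
    have hγK : γH.1 ∈ K := (Subgroup.mem_prod.1 hγ).1
    have hx₀ : glVertexAct (isUniformizingElement_of_v_eq hϖF) g ⟨latt (1 : Matrix (Fin 2) (Fin 2) (v.adicCompletion ↥(maximalRealSubfield L))), hx₀S⟩ =
        ⟨latt (1 : Matrix (Fin 2) (Fin 2) (v.adicCompletion ↥(maximalRealSubfield L))), hx₀S⟩ :=
      (rhoVertexActPlace_eq_iff_glVertexAct_eq L v w hw hα₀ hα₀0 hϖF U hs hsg _ _).1 ((hK γH.1).1 hγK)
    haveI := compactSpace_centralizer_endoPair_of_not_exists_isRoot_nonsplit L v w hw γH hirr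
    have hfinQ := finite_fixedBy_quotient_of_isClosed γH _ (isClosed_conjClass_localH_of_isLocalGRegular L v γH hreg) hKo hKc
    have hfinM := (finite_fixedBy_quotient_prod_iff_fixedVertices_onePlace L v w hw hα₀ hα₀0 hϖF he K
      (localNonsplitEquiv (IsCMField.complexConj L) (Matrix.of fun i j : Fin 2 => if i.val + j.val + 1 = 2 then (1 : L) else 0) (IsCMField.complexConj_ne_one L) w hw)
      ⟨latt (1 : Matrix (Fin 2) (Fin 2) (v.adicCompletion ↥(maximalRealSubfield L))), hx₀S⟩ rfl hK γH).1 hfinQ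
    have hfin : {x : {M : Submodule 𝒪[v.adicCompletion ↥(maximalRealSubfield L)] (Fin 2 → v.adicCompletion ↥(maximalRealSubfield L)) //
        IsSpecialLattice (RingHom.id _) (HeckeCharacter.uniformizer ↥(maximalRealSubfield L) v : v.adicCompletion ↥(maximalRealSubfield L)) !![(0 : v.adicCompletion ↥(maximalRealSubfield L)), 1; -1, 0] M} |
          glVertexAct (isUniformizingElement_of_v_eq hϖF) g x = x}.Finite := by
      refine hfinM.subset fun x hx => ?_
      exact (rhoVertexActPlace_eq_iff_glVertexAct_eq L v w hw hα₀ hα₀0 hϖF U hs hsg x x).2 hx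
    obtain ⟨K₂, -, -, hK1mem, hKo', hKc', -⟩ := exists_vertexCover_of_ramified_wild L v w hw he ϖu hϖ
    have hrel := natCard_fixedBy_cmLocalIntegralLevel_add_one_eq_natCard_fixedBy_modular_of_v_eq_exp_neg_one L v w hw hα₀ hα₀0 hϖF he hvα₀ ϖu hϖ (K₂ 1) hK1mem γH.1 hs hsg hx₀ hfin
    rw [vertexProfile_div_eq_natCard_fixedBy_of_mod_two_eq_one L w hw he νH hd2 ϖu hϖ (K₂ 1) hK1mem (hKo' 1) (hKc' 1) hmH hreg hirr, hd2, ← hrel]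
    push_cast
    ring

end Place

end Summit.HodgeConjecture.HodgeConjecture.Cruxes.H413.F0P3cDyRamHProfilesTypeTwoVertexCount

end
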